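import Mathlib.Algebra.Group.Pi.Lemmas
import Mathlib.Algebra.Group.Submonoid.Operations
import Literature.AlgebraicGeometry.Frobenioids.Monoids
import Literature.AlgebraicGeometry.Frobenioids.ElementaryFrobenioid
import Literature.AlgebraicGeometry.Frobenioids.MonoidRealification
import HarnessLib

/-!
# Frobenioids I, §2: perf-factorial monoids and the realification `M^rlf` (Definition 2.4 (i))

Mochizuki, *The geometry of Frobenioids I*, Kyushu J. Math. **62** (2008), §2, Definition 2.4 (i),
kurims pp. 47–48 [cite: MochizukiFrdI2008, Def. 2.4(i) p.47].

`M ∈ Ob(Mon)` is *perf-factorial* if (a) `M` is divisorial; (b) for every `𝔭 ∈ Prime(M)` the monoid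
`M_𝔭` is monoprime; (c) the map `M^pf → M^rlf_factor := ∏_𝔭 M^rlf_𝔭`,
`a ↦ (…, sup(Bound_{𝔭 ∪ {0}}(a)), …)` — where `M^rlf_𝔭 := M^pf_𝔭 ⊗ ℝ_{≥0}` and the sup at `𝔭`
is taken in `M^rlf_𝔭` — is a well-defined [i.e. the various `Bound_{𝔭 ∪ {0}}(a) ⊆ M^rlf_𝔭` are
bounded subsets] injective homomorphism of monoids whose image lies in `M^pf_factor := ∏_𝔭 M^pf_𝔭`
(the *factorization homomorphism*, by which `M^pf` is regarded as a submonoid of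
`M^pf_factor ⊆ M^rlf_factor`); (d) writing `Supp(a) ⊆ Prime(M)` for the set of `𝔭` at which the
component of `a ∈ M^rlf_factor` is nonzero: if `a ∈ M^pf_factor` and `b ∈ M^pf` satisfy
`Supp(a) ⊆ Supp(b)`, then `a ∈ M^pf`.  For perf-factorial `M`, the *realification*
`M^rlf ⊆ M^rlf_factor` is the submonoid of the `a` with `Supp(a) ⊆ Supp(b)` for some `b ∈ M^pf`;
"one verifies immediately that `M^pf`, `M^rlf` are also perf-factorial".

**Rendering.** Multiplicative notation as in `Monoids.lean` (`0 ↦ 1`, `≤ ↦ ∣`).  The factors are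
indexed by `Prime(M^pf)`, identified with `Prime(M)` by the bijection of §0 p. 12
(`primes_equiv_primes_perfection`); `M^pf_𝔮 := (M^pf)_𝔮` and `M^rlf_𝔮 := M^pf_𝔮 ⊗ ℝ_{≥0}`
(`MonoidRealification.lean`).  The supremum for the divisibility order is the total function
`divSup` (the element `s` with "bounded by `b` iff `s ≤ b`" when it exists — it does, uniquely, in an
`ℝ`-monoprime monoid, §0 p. 12 — and `0` otherwise), so the factorization map `factorMap` is a plain
function for every `M` and conditions (c), (d) are predicates on it.  The closing claims ("`≤` in
`M^rlf` iff in `M^rlf_factor`", "`M^pf`, `M^rlf` are perf-factorial") are recorded as statements.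
-/

noncomputable section

namespace Literature.AlgebraicGeometry.Frobenioids

open Function

universe u

section DivSup

variable {N : Type u} [CommMonoid N]

open Classical in
/-- The supremum of a subset for the divisibility order `≤` of §0: the element `s` such that
"`S` is bounded by `b` if and only if `b ≥ s`" (§0 p. 12), when such an `s` exists (it is then used
through `divSup_spec`); `0` (i.e. `1`) otherwise. [cite: MochizukiFrdI2008, §0 p.12] -/
def divSup (S : Set N) : N :=
  if h : ∃ s : N, ∀ b : N, IsBoundedBy S b ↔ s ∣ b then h.choose else 1

/-- The defining property of `divSup S` when a supremum exists. [cite: MochizukiFrdI2008, §0 p.12] -/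
theorem divSup_spec {S : Set N} (h : ∃ s : N, ∀ b : N, IsBoundedBy S b ↔ s ∣ b) (b : N) :
    IsBoundedBy S b ↔ divSup S ∣ b := by
  classical
  rw [divSup, dif_pos h]
  exact h.choose_spec b

/-- In an `ℝ`-monoprime monoid every bounded subset has a supremum (§0 p. 12), so `divSup` computes
it. [cite: MochizukiFrdI2008, §0 p.12] -/
theorem divSup_spec_of_isRMonoprime (hN : IsRMonoprime N) {S : Set N} {b₀ : N}
    (hb₀ : IsBoundedBy S b₀) (b : N) : IsBoundedBy S b ↔ divSup S ∣ b :=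
  divSup_spec (existsUnique_sup_of_isRMonoprime hN S b₀ hb₀).exists b

end DivSup

section PerfFactorial

variable (M : Type u) [CommMonoid M]

/-- `M^pf_𝔮 := (M^pf)_𝔮`, the submonoid of `M^pf` generated by the prime `𝔮` (§0 p. 12), for
`𝔮 ∈ Prime(M^pf) ≅ Prime(M)`. [cite: MochizukiFrdI2008, Def. 2.4(i) p.47] -/
abbrev PfAt (𝔮 : Primes (Perfection M)) : Type u := ↥(𝔮.submonoid)

/-- `M^rlf_𝔮 := M^pf_𝔮 ⊗ ℝ_{≥0}` (Def. 2.4 (i)(c)). [cite: MochizukiFrdI2008, Def. 2.4(i) p.47] -/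
abbrev RlfAt (𝔮 : Primes (Perfection M)) : Type u := Realification (PfAt M 𝔮)

/-- `M^pf_factor := ∏_𝔮 M^pf_𝔮` (Def. 2.4 (i)(c)). [cite: MochizukiFrdI2008, Def. 2.4(i) p.47] -/
abbrev PfFactor : Type u := ∀ 𝔮 : Primes (Perfection M), PfAt M 𝔮

/-- `M^rlf_factor := ∏_𝔮 M^rlf_𝔮` (Def. 2.4 (i)(c)). [cite: MochizukiFrdI2008, Def. 2.4(i) p.47] -/
abbrev RlfFactor : Type u := ∀ 𝔮 : Primes (Perfection M), RlfAt M 𝔮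

/-- The componentwise natural map `M^pf_factor → M^rlf_factor` (`M^pf_𝔮 → M^pf_𝔮 ⊗ ℝ_{≥0}` in each
factor), through which `M^pf_factor ⊆ M^rlf_factor`. [cite: MochizukiFrdI2008, Def. 2.4(i) p.47] -/
def pfFactorToRlfFactor : PfFactor M →* RlfFactor M where
  toFun x 𝔮 := Realification.of (PfAt M 𝔮) (x 𝔮)
  map_one' := funext fun 𝔮 => map_one (Realification.of (PfAt M 𝔮))
  map_mul' x y := funext fun 𝔮 => map_mul (Realification.of (PfAt M 𝔮)) (x 𝔮) (y 𝔮)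

/-- `pfFactorToRlfFactor` componentwise. [cite: MochizukiFrdI2008, Def. 2.4(i) p.47] -/
@[simp] theorem pfFactorToRlfFactor_apply (x : PfFactor M) (𝔮 : Primes (Perfection M)) :
    pfFactorToRlfFactor M x 𝔮 = Realification.of (PfAt M 𝔮) (x 𝔮) := rfl

/-- `Bound_{𝔮 ∪ {0}}(a) ⊆ M^rlf_𝔮` for `a ∈ M^pf`: the images in `M^rlf_𝔮` of the elements `x` of
`𝔮 ∪ {0}` (primary elements of the class `𝔮`, or `0`) with `x ≤ a` in `M^pf` (Def. 2.4 (i)(c);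
`Bound_S(b)` as in §0 p. 12). [cite: MochizukiFrdI2008, Def. 2.4(i) p.47] -/
def boundAt (𝔮 : Primes (Perfection M)) (a : Perfection M) : Set (RlfAt M 𝔮) :=
  {y | ∃ x : PfAt M 𝔮, (x.1 ∈ 𝔮.carrier ∨ x.1 = 1) ∧ x.1 ∣ a ∧ y = Realification.of (PfAt M 𝔮) x}

/-- The factorization map `M^pf → M^rlf_factor`, `a ↦ (…, sup(Bound_{𝔮 ∪ {0}}(a)), …)`, the sup
at `𝔮` taken in `M^rlf_𝔮` (Def. 2.4 (i)(c)); a plain function — that it is a well-defined injective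
homomorphism is condition (c) of "perf-factorial". [cite: MochizukiFrdI2008, Def. 2.4(i) p.47] -/
def factorMap (a : Perfection M) : RlfFactor M := fun 𝔮 => divSup (boundAt M 𝔮 a)

variable {M} in
/-- `Supp(a) ⊆ Prime(M)` for `a ∈ M^rlf_factor`: the primes at which the component of `a` is
nonzero (Def. 2.4 (i)(d)). [cite: MochizukiFrdI2008, Def. 2.4(i) p.47] -/
def supp (a : RlfFactor M) : Set (Primes (Perfection M)) := {𝔮 | a 𝔮 ≠ 1}

/-- **Definition 2.4 (i): perf-factorial monoids.** [cite: MochizukiFrdI2008, Def. 2.4(i) p.47] -/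
structure IsPerfFactorial : Prop where
  /-- (a) `M` is divisorial -/
  isDivisorial : IsDivisorial M
  /-- (b) every `M_𝔭`, `𝔭 ∈ Prime(M)`, is monoprime -/
  isMonoprime : ∀ 𝔭 : Primes M, IsMonoprime ↥(𝔭.submonoid)
  /-- (c) well-defined: each `Bound_{𝔮 ∪ {0}}(a) ⊆ M^rlf_𝔮` is a bounded subset -/
  bounded : ∀ (𝔮 : Primes (Perfection M)) (a : Perfection M), ∃ b, IsBoundedBy (boundAt M 𝔮 a) b
  /-- (c) homomorphism: unit -/
  factorMap_one : factorMap M 1 = 1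
  /-- (c) homomorphism: products -/
  factorMap_mul : ∀ a b : Perfection M, factorMap M (a * b) = factorMap M a * factorMap M b
  /-- (c) injective -/
  factorMap_injective : Injective (factorMap M)
  /-- (c) the image lies in `M^pf_factor = ∏_𝔮 M^pf_𝔮 ⊆ M^rlf_factor` -/
  factorMap_mem_range : ∀ a : Perfection M, factorMap M a ∈ Set.range (pfFactorToRlfFactor M)
  /-- (d) if `a ∈ M^pf_factor`, `b ∈ M^pf` and `Supp(a) ⊆ Supp(b)` then `a ∈ M^pf` -/
  mem_range_of_supp_subset : ∀ (x : PfFactor M) (b : Perfection M),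
    supp (pfFactorToRlfFactor M x) ⊆ supp (factorMap M b) →
      pfFactorToRlfFactor M x ∈ Set.range (factorMap M)

variable {M}

/-- The factorization homomorphism `M^pf → M^rlf_factor` of a perf-factorial monoid, as a monoid
homomorphism (Def. 2.4 (i)(c)). [cite: MochizukiFrdI2008, Def. 2.4(i) p.47] -/
def IsPerfFactorial.factorHom (h : IsPerfFactorial M) : Perfection M →* RlfFactor M where
  toFun := factorMap M
  map_one' := h.factorMap_one
  map_mul' := h.factorMap_mul

/-- `factorHom` is `factorMap`. [cite: MochizukiFrdI2008, Def. 2.4(i) p.47] -/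
@[simp] theorem IsPerfFactorial.factorHom_apply (h : IsPerfFactorial M) (a : Perfection M) :
    h.factorHom a = factorMap M a := rfl

/-- The component of `factorMap a` at `𝔮` is the supremum of `Bound_{𝔮 ∪ {0}}(a)`: "bounded by `b`
iff `b ≥` the component", whenever that set is bounded and `M^rlf_𝔮` is `ℝ`-monoprime.
[cite: MochizukiFrdI2008, Def. 2.4(i) p.47] -/
theorem factorMap_spec {𝔮 : Primes (Perfection M)} (h𝔮 : IsRMonoprime (RlfAt M 𝔮)) {a : Perfection M}
    {b₀ : RlfAt M 𝔮} (hb₀ : IsBoundedBy (boundAt M 𝔮 a) b₀) (b : RlfAt M 𝔮) :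
    IsBoundedBy (boundAt M 𝔮 a) b ↔ factorMap M a 𝔮 ∣ b :=
  divSup_spec_of_isRMonoprime h𝔮 hb₀ b

/-- `M ⊗ ℝ_{≥0}` is always sharp (`ℝ_{≥0}` has no units but `0`), so in particular each `M^rlf_𝔮` is.
[cite: MochizukiFrdI2008, Def. 2.4(i) p.47] -/
theorem isSharp_realification (N : Type u) [CommMonoid N] : IsSharp (Realification N) := by
  refine ⟨fun u hu => ?_⟩
  obtain ⟨v, hv⟩ := hu.exists_right_inv
  apply MonoidHom.ext
  intro f
  have h := DFunLike.congr_fun (show (show RDual N →* Multiplicative NNReal from u) *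
    (show RDual N →* Multiplicative NNReal from v) = 1 from hv) f
  rw [MonoidHom.mul_apply, MonoidHom.one_apply] at h
  have h' : Multiplicative.toAdd ((show RDual N →* Multiplicative NNReal from u) f) +
      Multiplicative.toAdd ((show RDual N →* Multiplicative NNReal from v) f) = 0 :=
    congrArg Multiplicative.toAdd h
  have hle : Multiplicative.toAdd ((show RDual N →* Multiplicative NNReal from u) f) ≤ 0 :=
    le_self_add.trans h'.le
  exact Multiplicative.toAdd.injective (nonpos_iff_eq_zero.mp hle)

/-- `Supp` of a product is contained in the union of the `Supp`s. [cite: MochizukiFrdI2008, Def. 2.4(i) p.48] -/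
theorem supp_mul_subset (a b : RlfFactor M) : supp (a * b) ⊆ supp a ∪ supp b := by
  intro 𝔮 h
  by_contra h'
  simp only [Set.mem_union, supp, Set.mem_setOf_eq, not_or, not_not] at h'
  exact h (by rw [Pi.mul_apply, h'.1, h'.2, mul_one])

/-- `Supp(a) ⊆ Supp(a · b)` in `M^rlf_factor` (each factor is sharp). [cite: MochizukiFrdI2008, Def. 2.4(i) p.48] -/
theorem supp_subset_supp_mul (a b : RlfFactor M) : supp a ⊆ supp (a * b) := by
  intro 𝔮 h h'
  rw [Pi.mul_apply] at h'
  exact h ((isSharp_realification _).1 _ (IsUnit.of_mul_eq_one _ h'))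

/-- **The realification** `M^rlf ⊆ M^rlf_factor` of a perf-factorial monoid: the submonoid [it is
one: "easily verified"] of the `a` such that `Supp(a) ⊆ Supp(b)` for some `b ∈ M^pf`
(Def. 2.4 (i), p. 48). [cite: MochizukiFrdI2008, Def. 2.4(i) p.48] -/
def IsPerfFactorial.realification (h : IsPerfFactorial M) : Submonoid (RlfFactor M) where
  carrier := {a | ∃ b : Perfection M, supp a ⊆ supp (factorMap M b)}
  one_mem' := ⟨1, fun 𝔮 h𝔮 => (h𝔮 rfl).elim⟩
  mul_mem' := by
    rintro a a' ⟨b, hb⟩ ⟨b', hb'⟩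
    refine ⟨b * b', fun 𝔮 h𝔮 => ?_⟩
    rw [h.factorMap_mul]
    rcases supp_mul_subset a a' h𝔮 with h₁ | h₁
    · exact supp_subset_supp_mul _ _ (hb h₁)
    · rw [mul_comm]
      exact supp_subset_supp_mul _ _ (hb' h₁)

/-- `M^pf ⊆ M^rlf`: the factorization homomorphism lands in the realification.
[cite: MochizukiFrdI2008, Def. 2.4(i) p.48] -/
theorem IsPerfFactorial.factorMap_mem_realification (h : IsPerfFactorial M) (a : Perfection M) :
    factorMap M a ∈ h.realification :=
  ⟨a, subset_rfl⟩

/-- The natural map `M^pf → M^rlf` (the factorization homomorphism with values in the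
realification), hence `M → M^pf → M^rlf`. [cite: MochizukiFrdI2008, Def. 2.4(i) p.48] -/
def IsPerfFactorial.toRealification (h : IsPerfFactorial M) : Perfection M →* ↥h.realification :=
  h.factorHom.codRestrict _ h.factorMap_mem_realification

/-- The type `M^rlf` of a perf-factorial monoid. [cite: MochizukiFrdI2008, Def. 2.4(i) p.48] -/
abbrev IsPerfFactorial.Rlf (h : IsPerfFactorial M) : Type u := ↥h.realification

/-! ### The closing claims of Definition 2.4 (i) (statements) -/

/-- "[Thus, in particular, if `a, b ∈ M^pf`, then an inequality `a ≤ b` holds in `M^pf` if and only if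
it holds in `M^pf_factor`]" (Def. 2.4 (i)(d)): divisibility on the right is taken inside
`M^pf_factor = ∏_𝔮 M^pf_𝔮` (the quotient is required to lie in the image of `M^pf_factor`), as printed
(referee A4-F6); stated for perf-factorial `M`, inside whose condition (d) the bracket sits (audit
RQ7-L1t2-F2). [cite: MochizukiFrdI2008, Def. 2.4(i) p.47] -/
def PfLeIffFactor (M : Type u) [CommMonoid M] : Prop :=
  IsPerfFactorial M →
    ∀ a b : Perfection M, a ∣ b ↔ ∃ x : PfFactor M, factorMap M a * pfFactorToRlfFactor M x = factorMap M b

/-- "if `a, b ∈ M^rlf`, then an inequality `a ≤ b` holds in `M^rlf` if and only if it holds in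
`M^rlf_factor`" (Def. 2.4 (i), p. 48). [cite: MochizukiFrdI2008, Def. 2.4(i) p.48] -/
def IsPerfFactorial.RlfLeIffFactor (h : IsPerfFactorial M) : Prop :=
  ∀ a b : h.Rlf, a ∣ b ↔ (a : RlfFactor M) ∣ (b : RlfFactor M)

/-- "Finally, one verifies immediately that `M^pf` … [is] also perf-factorial" (Def. 2.4 (i), p. 48).
[cite: MochizukiFrdI2008, Def. 2.4(i) p.48] -/
def PerfectionIsPerfFactorial (M : Type u) [CommMonoid M] : Prop :=
  IsPerfFactorial M → IsPerfFactorial (Perfection M)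

/-- "… one verifies immediately that … `M^rlf` [is] also perf-factorial" (Def. 2.4 (i), p. 48).
[cite: MochizukiFrdI2008, Def. 2.4(i) p.48] -/
def IsPerfFactorial.RealificationIsPerfFactorial (h : IsPerfFactorial M) : Prop :=
  IsPerfFactorial h.Rlf

end PerfFactorial

/-! ### Definition 2.4 (ii): "`Λ` supports `M`" -/

section Supports

/-- A *monoid type* `Λ ∈ {ℤ, ℚ, ℝ}` (§0 p. 10). [cite: MochizukiFrdI2008, §0 p.10] -/
inductive MonoidType : Type
  /-- `Λ = ℤ` -/
  | Z
  /-- `Λ = ℚ` -/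
  | Q
  /-- `Λ = ℝ` -/
  | R
  deriving DecidableEq

variable (M : Type u) [CommMonoid M]

/-- **Definition 2.4 (ii)**: "`Λ` supports `M`" if (a) `Λ = ℤ`; or (b) `Λ = ℚ` and `M` is perfect; or
(c) `Λ = ℝ`, `M` is perfect and perf-factorial, and every `M_𝔭`, `𝔭 ∈ Prime(M)`, is `ℝ`-monoprime.
[cite: MochizukiFrdI2008, Def. 2.4(ii) p.48] -/
def Supports : MonoidType → Prop
  | .Z => True
  | .Q => IsPerfect M
  | .R => IsPerfect M ∧ IsPerfFactorial M ∧ ∀ 𝔭 : Primes M, IsRMonoprime ↥(𝔭.submonoid)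

/-- `ℤ` supports every `M`. [cite: MochizukiFrdI2008, Def. 2.4(ii) p.48] -/
@[simp] theorem supports_Z : Supports M .Z := trivial

/-- `ℚ` supports `M` iff `M` is perfect. [cite: MochizukiFrdI2008, Def. 2.4(ii) p.48] -/
@[simp] theorem supports_Q_iff : Supports M .Q ↔ IsPerfect M := Iff.rfl

variable {M}

/-- "Note that if `Λ` supports `M`, then `Λ_{>0}` acts naturally on `M`" — the case `Λ = ℤ`:
`ℕ_{≥1}` acts by `d ↦ (a ↦ d · a)` (powers). [cite: MochizukiFrdI2008, Def. 2.4(ii) p.48] -/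
def natPosAction : ℕ+ →* Monoid.End M where
  toFun d := powMonoidHom (d : ℕ)
  map_one' := by
    apply MonoidHom.ext
    intro a
    show a ^ ((1 : ℕ+) : ℕ) = a
    rw [PNat.one_coe, pow_one]
  map_mul' d d' := by
    apply MonoidHom.ext
    intro a
    show a ^ ((d * d' : ℕ+) : ℕ) = (a ^ (d' : ℕ)) ^ (d : ℕ)
    rw [PNat.mul_coe, pow_mul']

/-- The case `Λ = ℚ`: in a perfect monoid the `n`-th power maps are bijections, so `ℚ_{>0}` acts by
`a ↦ (a^m)^{1/n}` for `d = m/n`; here the `n`-th root as the inverse of the `n`-th power bijection.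
[cite: MochizukiFrdI2008, Def. 2.4(ii) p.48] -/
def IsPerfect.root (h : IsPerfect M) (n : ℕ+) : M → M :=
  Function.surjInv (h.bijective_pow n n.pos).2

/-- `(root n a)^n = a`. [cite: MochizukiFrdI2008, Def. 2.4(ii) p.48] -/
theorem IsPerfect.root_pow (h : IsPerfect M) (n : ℕ+) (a : M) : h.root n a ^ (n : ℕ) = a :=
  Function.surjInv_eq (h.bijective_pow n n.pos).2 a

/-- `root n (a^n) = a`. [cite: MochizukiFrdI2008, Def. 2.4(ii) p.48] -/
theorem IsPerfect.root_pow_self (h : IsPerfect M) (n : ℕ+) (a : M) : h.root n (a ^ (n : ℕ)) = a :=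
  Function.leftInverse_surjInv (h.bijective_pow n n.pos) a

/-- The `ℚ_{>0}`-action on a perfect monoid: `d = m/n ↦ (a ↦ root_n (a^m))` (Def. 2.4 (ii), `Λ = ℚ`;
written on the numerator/denominator of `d`).  The case `Λ = ℝ` (via the realification) is not
constructed here. [cite: MochizukiFrdI2008, Def. 2.4(ii) p.48] -/
def IsPerfect.ratPosAct (h : IsPerfect M) (d : ℚ≥0) (a : M) : M :=
  h.root ⟨d.den, d.den_pos⟩ (a ^ d.num)

end Supports

end Literature.AlgebraicGeometry.Frobenioids
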